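import Summits.QuantumFields.YangMills.Theorems.AllWindowsColdBoxBoxHighLineSmearedFPOperatorPerturbation

/-!
# TASK T-S5.4J, brick J2 `OrbitMapContraction` — PRELIMINARIES that do not need the orbit-map derivative

Planner ym-idea-2 g18 (2026-08-29T18:11:01Z; `Cruxes/BoxWindowHighSU2213/TaskS5Laplace.lean`, J2, owner w2).  With `W = V^{pauliGauge A}`,
`J = ⊕_x jac(A_x)` and `DΨ_V = F(W)·J` (J1, w3), the contraction estimate is the algebra
`1 − F_V⁻¹·DΨ_V = (1 − J) + F_V⁻¹·(F_V − F(W))·J`.  This file supplies the derivative-free inputs: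

* `norm_coe_expPauli_sub_one_le`, `norm_coe_expPauli_inv_sub_one_le` : `‖↑(expPauli a)^{±1} − 1‖ ≤ 4‖a‖` for `‖a‖ ≤ 1`;
* `norm_coe_gaugeTransformZd_expPauli_sub_le` : the LINK DISPLACEMENT `‖↑((U^{exp ia})_e) − ↑(U_e)‖ ≤ 24·t` when `‖a‖ ≤ t ≤ 1` at both
  endpoints, and its `pauliGauge` form `norm_coe_gaugeTransformZd_pauliGauge_sub_le` (so ✓`fpOperator_sub_opBound` gives
  `‖F(V^{pauliGauge A}) − F(V)‖₂→₂ ≤ 84·24·a`, `fpOperator_pauliGauge_sub_opBound`);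
* `sqrt_dotProduct_add_le` (ℓ² triangle inequality in `dotProduct` letters) and the abstract contraction lemma
  **`contraction_opBound`**: `K·F_V = 1`, `‖K‖ ≤ k`, `‖F_V − F_W‖ ≤ m`, `‖1 − J‖ ≤ ε`, `‖J‖ ≤ j` ⟹ `‖(1 − K·F_W·J) w‖ ≤ (ε + k·m·j)‖w‖`
  (all in the squared `dotProduct` form of the task file).

HONEST LABEL: preliminaries of one brick of T-S5.4J; J2 itself waits on J1's derivative; T-S5.4J, S5, U5, ⟨24004⟩ ⟨24335⟩ ⟨24336⟩ remain OPEN;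
no crux, rung or summit is proved; the Yang–Mills mass gap is NOT proved by this file.
-/

set_option autoImplicit false

noncomputable section

open Matrix Finset
open scoped Matrix.Norms.Operator
open Literature.MathematicalPhysics.QuantumFieldTheory.Balaban1983to89.B10Eq18SigmaSU2 (su2Coord)
open Literature.MathematicalPhysics.QuantumFieldTheory.Balaban1983to89.B10Eq18SigmaSU2Haar (expPauli)
open Literature.MathematicalPhysics.QuantumFieldTheory.AxialGauge (boxEdges)
open Literature.MathematicalPhysics.QuantumLattice (LGConfig ZdEdge gaugeTransformZd)
open Literature.Probability.LatticeModels (Site)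

namespace Summit.QuantumFields.YangMills.Theorems.AllWindowsColdBoxBoxHighLine

/-! ## Near-identity chart points -/

/-- `‖↑(expPauli a) − 1‖ ≤ 4‖a‖` for `‖a‖ ≤ 1` (`= (cos t − 1)·1 + sinc t·X`, `|cos t − 1| ≤ t²/2 ≤ t/2`, `‖X‖ ≤ 3t`). -/
theorem norm_coe_expPauli_sub_one_le (a : EuclideanSpace ℝ (Fin 3)) (ha : ‖a‖ ≤ 1) :
    ‖((expPauli a : SU2) : Matrix (Fin 2) (Fin 2) ℂ) - 1‖ ≤ 4 * ‖a‖ := by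
  have h0 : 0 ≤ ‖a‖ := norm_nonneg a
  have hcos : |Real.cos ‖a‖ - 1| ≤ ‖a‖ ^ 2 / 2 := by
    rw [abs_sub_comm, abs_of_nonneg (by linarith [Real.cos_le_one ‖a‖])]
    linarith [Real.one_sub_sq_div_two_le_cos (x := ‖a‖)]
  have hsinc : |Real.sinc ‖a‖| ≤ 1 := Real.abs_sinc_le_one _
  rw [coe_expPauli_eq, add_sub_right_comm]
  have hrw : (Real.cos ‖a‖ : ℂ) • (1 : Matrix (Fin 2) (Fin 2) ℂ) - 1 = (((Real.cos ‖a‖ - 1 : ℝ) : ℂ)) • (1 : Matrix (Fin 2) (Fin 2) ℂ) := by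
    rw [Complex.ofReal_sub, Complex.ofReal_one, sub_smul, one_smul]
  rw [hrw]
  calc _ ≤ ‖(((Real.cos ‖a‖ - 1 : ℝ) : ℂ)) • (1 : Matrix (Fin 2) (Fin 2) ℂ)‖ + ‖((Real.sinc ‖a‖ : ℝ) : ℂ) • su2Coord a‖ := norm_add_le _ _
    _ ≤ ‖a‖ ^ 2 / 2 * 1 + 1 * (3 * ‖a‖) := by
        rw [norm_smul, norm_smul, Complex.norm_real, Complex.norm_real, Real.norm_eq_abs, Real.norm_eq_abs, norm_one]
        exact add_le_add (mul_le_mul hcos le_rfl zero_le_one (by positivity))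
          (mul_le_mul hsinc (Parity.norm_su2Coord_le a) (norm_nonneg _) zero_le_one)
    _ ≤ 4 * ‖a‖ := by nlinarith

/-- `‖↑((expPauli a)⁻¹) − 1‖ ≤ 4‖a‖` for `‖a‖ ≤ 1`. -/
theorem norm_coe_expPauli_inv_sub_one_le (a : EuclideanSpace ℝ (Fin 3)) (ha : ‖a‖ ≤ 1) :
    ‖(((expPauli a)⁻¹ : SU2) : Matrix (Fin 2) (Fin 2) ℂ) - 1‖ ≤ 4 * ‖a‖ := by
  have h0 : 0 ≤ ‖a‖ := norm_nonneg a
  have hcos : |Real.cos ‖a‖ - 1| ≤ ‖a‖ ^ 2 / 2 := by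
    rw [abs_sub_comm, abs_of_nonneg (by linarith [Real.cos_le_one ‖a‖])]
    linarith [Real.one_sub_sq_div_two_le_cos (x := ‖a‖)]
  have hsinc : |Real.sinc ‖a‖| ≤ 1 := Real.abs_sinc_le_one _
  rw [coe_expPauli_inv_eq, sub_sub, add_comm ((Real.sinc ‖a‖ : ℂ) • su2Coord a) 1, ← sub_sub]
  have hrw : (Real.cos ‖a‖ : ℂ) • (1 : Matrix (Fin 2) (Fin 2) ℂ) - 1 = (((Real.cos ‖a‖ - 1 : ℝ) : ℂ)) • (1 : Matrix (Fin 2) (Fin 2) ℂ) := by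
    rw [Complex.ofReal_sub, Complex.ofReal_one, sub_smul, one_smul]
  rw [hrw]
  calc _ ≤ ‖(((Real.cos ‖a‖ - 1 : ℝ) : ℂ)) • (1 : Matrix (Fin 2) (Fin 2) ℂ)‖ + ‖((Real.sinc ‖a‖ : ℝ) : ℂ) • su2Coord a‖ := norm_sub_le _ _
    _ ≤ ‖a‖ ^ 2 / 2 * 1 + 1 * (3 * ‖a‖) := by
        rw [norm_smul, norm_smul, Complex.norm_real, Complex.norm_real, Real.norm_eq_abs, Real.norm_eq_abs, norm_one]
        exact add_le_add (mul_le_mul hcos le_rfl zero_le_one (by positivity))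
          (mul_le_mul hsinc (Parity.norm_su2Coord_le a) (norm_nonneg _) zero_le_one)
    _ ≤ 4 * ‖a‖ := by nlinarith

/-! ## Link displacement by a near-identity Pauli gauge transformation -/

/-- **Link displacement**: `‖↑((U^{exp ia})_e) − ↑(U_e)‖ ≤ 24·t` when `‖a e₋‖, ‖a e₊‖ ≤ t ≤ 1`
(`g U h⁻¹ − U = (g − 1)·U·h⁻¹ + U·(h⁻¹ − 1)`, `‖U‖, ‖h⁻¹‖ ≤ 2`). -/
theorem norm_coe_gaugeTransformZd_expPauli_sub_le (U : LGConfig 4 SU2) (a : Site 4 → EuclideanSpace ℝ (Fin 3)) (e : ZdEdge 4) {t : ℝ}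
    (ht : t ≤ 1) (h1 : ‖a e.1‖ ≤ t) (h2 : ‖a (e.1 + Pi.single e.2 1)‖ ≤ t) :
    ‖((gaugeTransformZd (fun z => expPauli (a z)) U e : SU2) : Matrix (Fin 2) (Fin 2) ℂ) - (U e : Matrix (Fin 2) (Fin 2) ℂ)‖ ≤ 24 * t := by
  have hcoe : ((gaugeTransformZd (fun z => expPauli (a z)) U e : SU2) : Matrix (Fin 2) (Fin 2) ℂ) =
      ((expPauli (a e.1) : SU2) : Matrix (Fin 2) (Fin 2) ℂ) * (U e : Matrix (Fin 2) (Fin 2) ℂ) *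
        (((expPauli (a (e.1 + Pi.single e.2 1)))⁻¹ : SU2) : Matrix (Fin 2) (Fin 2) ℂ) := by
    simp only [gaugeTransformZd, Submonoid.coe_mul]
  set G : Matrix (Fin 2) (Fin 2) ℂ := ((expPauli (a e.1) : SU2) : Matrix (Fin 2) (Fin 2) ℂ) with hG
  set K : Matrix (Fin 2) (Fin 2) ℂ := (((expPauli (a (e.1 + Pi.single e.2 1)))⁻¹ : SU2) : Matrix (Fin 2) (Fin 2) ℂ) with hK
  set P : Matrix (Fin 2) (Fin 2) ℂ := (U e : Matrix (Fin 2) (Fin 2) ℂ) with hP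
  have hGs : ‖G - 1‖ ≤ 4 * t := (norm_coe_expPauli_sub_one_le _ (h1.trans ht)).trans (by linarith)
  have hKs : ‖K - 1‖ ≤ 4 * t := (norm_coe_expPauli_inv_sub_one_le _ (h2.trans ht)).trans (by linarith)
  have hPn : ‖P‖ ≤ 2 := Parity.norm_coe_le_two (U e)
  have hKn : ‖K‖ ≤ 2 := Parity.norm_coe_le_two _
  have ht0 : 0 ≤ t := (norm_nonneg _).trans h1
  rw [hcoe]
  have hsplit : G * P * K - P = (G - 1) * P * K + P * (K - 1) := by noncomm_ring
  rw [hsplit]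
  calc ‖(G - 1) * P * K + P * (K - 1)‖ ≤ ‖(G - 1) * P * K‖ + ‖P * (K - 1)‖ := norm_add_le _ _
    _ ≤ ‖G - 1‖ * ‖P‖ * ‖K‖ + ‖P‖ * ‖K - 1‖ :=
        add_le_add ((norm_mul_le _ _).trans (mul_le_mul_of_nonneg_right (norm_mul_le _ _) (norm_nonneg _))) (norm_mul_le _ _)
    _ ≤ 4 * t * 2 * 2 + 2 * (4 * t) := by
        refine add_le_add ?_ (mul_le_mul hPn hKs (norm_nonneg _) (by norm_num))
        exact mul_le_mul (mul_le_mul hGs hPn (norm_nonneg _) (by positivity)) hKn (norm_nonneg _) (by positivity)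
    _ = 24 * t := by ring

/-- The `pauliGauge` form: `‖↑((V^{pauliGauge H A})_e) − ↑(V_e)‖ ≤ 24·t` on EVERY edge when `‖A x‖ ≤ t ≤ 1` at every interior site. -/
theorem norm_coe_gaugeTransformZd_pauliGauge_sub_le {H : ℕ} (V : LGConfig 4 SU2) (A : ↥(interiorSites H) → EuclideanSpace ℝ (Fin 3))
    {t : ℝ} (ht0 : 0 ≤ t) (ht : t ≤ 1) (hA : ∀ x, ‖A x‖ ≤ t) (e : ZdEdge 4) :
    ‖((gaugeTransformZd (extendGauge H fun y => expPauli (A y)) V e : SU2) : Matrix (Fin 2) (Fin 2) ℂ) - (V e : Matrix (Fin 2) (Fin 2) ℂ)‖ ≤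
      24 * t := by
  rw [extendGauge_expPauli]
  exact norm_coe_gaugeTransformZd_expPauli_sub_le V (extPauli H A) e ht (norm_extPauli_le A ht0 hA _) (norm_extPauli_le A ht0 hA _)

/-- **Two-configuration bound along the orbit**: `‖(F(V^{pauliGauge A}) − F(V)) v‖² ≤ (2016·t)²‖v‖²` when `‖A x‖ ≤ t ≤ 1`. -/
theorem fpOperator_pauliGauge_sub_opBound {H : ℕ} (V : LGConfig 4 SU2) (A : ↥(interiorSites H) → EuclideanSpace ℝ (Fin 3)) {t : ℝ}
    (ht0 : 0 ≤ t) (ht : t ≤ 1) (hA : ∀ x, ‖A x‖ ≤ t) (v : ↥(interiorSites H) × Fin 3 → ℝ) :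
    ((fpOperator H (gaugeTransformZd (extendGauge H fun y => expPauli (A y)) V) - fpOperator H V) *ᵥ v) ⬝ᵥ
        ((fpOperator H (gaugeTransformZd (extendGauge H fun y => expPauli (A y)) V) - fpOperator H V) *ᵥ v) ≤
      (2016 * t) ^ 2 * (v ⬝ᵥ v) := by
  have h := fpOperator_sub_opBound (gaugeTransformZd (extendGauge H fun y => expPauli (A y)) V) V
    (fun e _ => norm_coe_gaugeTransformZd_pauliGauge_sub_le V A ht0 ht hA e) v
  calc _ ≤ (84 * (24 * t)) ^ 2 * (v ⬝ᵥ v) := h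
    _ = (2016 * t) ^ 2 * (v ⬝ᵥ v) := by ring

/-! ## The abstract contraction algebra in `dotProduct` letters -/

/-- ℓ² triangle inequality in `dotProduct` letters. -/
theorem sqrt_dotProduct_add_le {ι : Type*} [Fintype ι] (x y : ι → ℝ) :
    Real.sqrt ((x + y) ⬝ᵥ (x + y)) ≤ Real.sqrt (x ⬝ᵥ x) + Real.sqrt (y ⬝ᵥ y) := by
  have key : ∀ z : ι → ℝ, Real.sqrt (z ⬝ᵥ z) = ‖(WithLp.toLp 2 z : EuclideanSpace ℝ ι)‖ := fun z => by
    rw [EuclideanSpace.norm_eq]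
    congr 1
    simp only [dotProduct, Real.norm_eq_abs, sq, abs_mul_abs_self]
  rw [key, key, key, WithLp.toLp_add]
  exact norm_add_le _ _

/-- From a squared bound to a `√`-bound: `(Mv)·(Mv) ≤ c²(v·v)`, `c ≥ 0` ⇒ `√((Mv)·(Mv)) ≤ c·√(v·v)`. -/
theorem sqrt_dotProduct_mulVec_le {ι : Type*} [Fintype ι] {M : Matrix ι ι ℝ} {c : ℝ} (hc : 0 ≤ c)
    (h : ∀ v : ι → ℝ, (M *ᵥ v) ⬝ᵥ (M *ᵥ v) ≤ c ^ 2 * (v ⬝ᵥ v)) (v : ι → ℝ) :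
    Real.sqrt ((M *ᵥ v) ⬝ᵥ (M *ᵥ v)) ≤ c * Real.sqrt (v ⬝ᵥ v) := by
  rw [← Real.sqrt_sq hc, ← Real.sqrt_mul (sq_nonneg c)]
  exact Real.sqrt_le_sqrt (h v)

/-- **Abstract contraction lemma.**  If `K·F_V = 1`, `‖K‖ ≤ k`, `‖F_V − F_W‖ ≤ m`, `‖1 − J‖ ≤ ε`, `‖J‖ ≤ j` (ℓ² operator bounds in squared
`dotProduct` form), then `‖(1 − K·F_W·J) w‖² ≤ (ε + k·m·j)²·‖w‖²` — because `1 − K F_W J = (1 − J) + K (F_V − F_W) J`. -/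
theorem contraction_opBound {ι : Type*} [Fintype ι] [DecidableEq ι] (K FV FW J : Matrix ι ι ℝ) (hKF : K * FV = 1) {k m ε j : ℝ}
    (hk : 0 ≤ k) (hm : 0 ≤ m) (hε : 0 ≤ ε) (hj : 0 ≤ j)
    (hK : ∀ v : ι → ℝ, (K *ᵥ v) ⬝ᵥ (K *ᵥ v) ≤ k ^ 2 * (v ⬝ᵥ v))
    (hL : ∀ v : ι → ℝ, ((FV - FW) *ᵥ v) ⬝ᵥ ((FV - FW) *ᵥ v) ≤ m ^ 2 * (v ⬝ᵥ v))
    (hJ1 : ∀ v : ι → ℝ, ((1 - J) *ᵥ v) ⬝ᵥ ((1 - J) *ᵥ v) ≤ ε ^ 2 * (v ⬝ᵥ v))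
    (hJ : ∀ v : ι → ℝ, (J *ᵥ v) ⬝ᵥ (J *ᵥ v) ≤ j ^ 2 * (v ⬝ᵥ v)) (w : ι → ℝ) :
    ((w - K *ᵥ ((FW * J) *ᵥ w)) ⬝ᵥ (w - K *ᵥ ((FW * J) *ᵥ w))) ≤ (ε + k * m * j) ^ 2 * (w ⬝ᵥ w) := by
  -- the algebraic identity
  have hid : w - K *ᵥ ((FW * J) *ᵥ w) = (1 - J) *ᵥ w + K *ᵥ ((FV - FW) *ᵥ (J *ᵥ w)) := by
    have h1 : K *ᵥ (FV *ᵥ (J *ᵥ w)) = J *ᵥ w := by rw [Matrix.mulVec_mulVec, hKF, Matrix.one_mulVec]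
    rw [Matrix.sub_mulVec, Matrix.one_mulVec, Matrix.sub_mulVec, Matrix.mulVec_sub, h1, ← Matrix.mulVec_mulVec]
    abel
  rw [hid]
  have hw0 : 0 ≤ w ⬝ᵥ w := Finset.sum_nonneg fun i _ => mul_self_nonneg _
  -- √ of every piece
  have n1 : Real.sqrt ((((1 - J) *ᵥ w)) ⬝ᵥ ((1 - J) *ᵥ w)) ≤ ε * Real.sqrt (w ⬝ᵥ w) := sqrt_dotProduct_mulVec_le hε hJ1 w
  have n2 : Real.sqrt ((K *ᵥ ((FV - FW) *ᵥ (J *ᵥ w))) ⬝ᵥ (K *ᵥ ((FV - FW) *ᵥ (J *ᵥ w)))) ≤ k * m * j * Real.sqrt (w ⬝ᵥ w) := by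
    calc _ ≤ k * Real.sqrt (((FV - FW) *ᵥ (J *ᵥ w)) ⬝ᵥ ((FV - FW) *ᵥ (J *ᵥ w))) := sqrt_dotProduct_mulVec_le hk hK _
      _ ≤ k * (m * Real.sqrt ((J *ᵥ w) ⬝ᵥ (J *ᵥ w))) := mul_le_mul_of_nonneg_left (sqrt_dotProduct_mulVec_le hm hL _) hk
      _ ≤ k * (m * (j * Real.sqrt (w ⬝ᵥ w))) :=
          mul_le_mul_of_nonneg_left (mul_le_mul_of_nonneg_left (sqrt_dotProduct_mulVec_le hj hJ _) hm) hk
      _ = k * m * j * Real.sqrt (w ⬝ᵥ w) := by ring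
  have ntot := (sqrt_dotProduct_add_le ((1 - J) *ᵥ w) (K *ᵥ ((FV - FW) *ᵥ (J *ᵥ w)))).trans (add_le_add n1 n2)
  -- square back
  have hlhs0 : 0 ≤ ((1 - J) *ᵥ w + K *ᵥ ((FV - FW) *ᵥ (J *ᵥ w))) ⬝ᵥ ((1 - J) *ᵥ w + K *ᵥ ((FV - FW) *ᵥ (J *ᵥ w))) :=
    Finset.sum_nonneg fun i _ => mul_self_nonneg _
  have hrhs0 : 0 ≤ (ε + k * m * j) * Real.sqrt (w ⬝ᵥ w) := by positivity
  have hsq := pow_le_pow_left₀ (Real.sqrt_nonneg _) (ntot.trans_eq (by ring : _ = (ε + k * m * j) * Real.sqrt (w ⬝ᵥ w))) 2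
  rw [Real.sq_sqrt hlhs0, mul_pow, Real.sq_sqrt hw0] at hsq
  exact hsq

end Summit.QuantumFields.YangMills.Theorems.AllWindowsColdBoxBoxHighLine

end
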